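import HarnessLib
import Literature.MathematicalPhysics.QuantumFieldTheory.Balaban1983to89.Beta.TransportLeg
import Literature.MathematicalPhysics.QuantumFieldTheory.Balaban1983to89.Beta.LeafK123Clauses

/-!
# Beta / LeafBlockLegs — the VALUE and GRADIENT block legs of Bałaban's scalar torus tower, kernel-checked:
# `ValDecay` and `GradDecay` (the two block-leg members of (2.35)) for `B1RG242Torus.tower P a 0`, all levels
# `1 ≤ j ≤ m + K`, by a DICTIONARY to the transported Combes–Thomas kernel theorem `TransportLeg.block_legs`

HONEST FRAMING (verbatim, page 1 of everything this cell writes): discharging `BetaPertH` makes Bałaban's UV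
stability UNCONDITIONAL — a real constructive-QFT result; it is NOT the continuum limit and NOT the Clay problem.
ABSOLUTE RULE: no internally-minted statement enters as a cited fact; every hypothesis below is either kernel-proved in
the tree or an explicit hypothesis of the theorem that uses it.  THIS MODULE asserts nothing printed: it is a
Mathlib-elementary certificate about Bałaban's concrete SCALAR (`U = 1`), MASSLESS (`m² = 0`) torus tower
`B1RG242Torus.tower P a 0` (pv07 lineage), obtained by combining tree modules.  Zero cited facts, zero `sorry`.

WHAT IS PROVED (the two block-leg estimates that `Beta/LeafK123Clauses` (an1) isolated as the hypothesis fields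
`ValDecay` / `GradDecay` of its supplier package `BlockLegDecay`, for the massless tower and `d ≥ 3`):
* `valDecay  (hd : 3 ≤ P.d) (ha : 0 < a) : LeafK123Clauses.ValDecay  P a 0 (cLeg P.d a) (dLeg P.d a)`, i.e.
  `|(G_j^{resc}Q_j^*)(x,y)| ≤ c_leg(d,a)·e^{−δ_leg(d,a)·L^{−j}T(x, fine y)}` for `1 ≤ j ≤ m + K`, all `x ∈ T^{(0)}`,
  `y ∈ T^{(j)}` (`G_j^{resc} = B5Display136Torus.Grs P a 0 j = (−Δ^{L^{−j}} + a_jQ_j^*Q_j)^{−1}`, `T` = the sup torus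
  distance of `B5Ineq137Torus`, `fine y` the block corner);
* `gradDecay (hd) (ha) : LeafK123Clauses.GradDecay P a 0 (cLeg P.d a) (dLeg P.d a)`, the same bound for the
  `L^{−j}`-lattice gradient `(∂^{L^{−j}}_μ G_j^{resc}Q_j^*)(x,y) = L^j·((G_j^{resc}Q_j^*)(x+e_μ,y) − (G_j^{resc}Q_j^*)(x,y))`;
* `blockLegDecay_of_covDecay`: hence `CovDecay P a 0 c₃ δ₃ → BlockLegDecay P a 0 (max c_leg c₃) (min δ_leg δ₃)`, so the
  ONE remaining input of the an1 lane's `(W3a)₀` tails for the massless scalar tower is the covariance family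
  `CovDecay` ((2.37); pv07's node G-pv07-5f / the an5 `FluctuationCovariance` dictionary) — then
  `LeafK123Clauses.leafK123_data{M,V,G}` and `{mixed,value,grad}Leg_tail_of_blockLegDecay` apply verbatim.
THE CONSTANTS `cLeg d a = K(d)·(2+a)/min{2,a/2}·e`, `dLeg d a = min{2,a/2}/(4(d+a+1))` depend on `d` and `a` ONLY
(`K(d)` = the constant of `TransportLeg.block_legs`, extracted as `Kleg d`): they are independent of the level `j`,
of `L`, of the cutoff `K` and of the volume `m` — uniformity over the levels comes from `a_j ∈ [a/2, a]`
(`aSeq_range`: `a(1 − L^{−2}) < a_j ≤ a`, `L ≥ 2`) and the monotonicity of the `TransportLeg` rate/constant in `a`.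

THE ROUTE (a dictionary, §1–§2, then bookkeeping, §3–§4).  For `1 ≤ j ≤ m + K` put `n + 1 = L^j`.  The finest torus
`T^{(0)} = Site P 0` (`2L^{m+K}` sites per direction) IS the fine torus `Tor (fine (n+1) (Nv P j))` of the
`B5Prop11Plancherel`/`B5Blocks16` block geometry over the coarse torus `Tor (Nv P j) ≡ Site P j`
(`(n+1)·(2L^{m+K−j}) = 2L^{m+K}`, `B5Ineq137Torus.pow_mul_sitesPerDir`): the coordinatewise `val`-preserving maps
`toTor`/`ofTor` form an equivalence `torEquiv` carrying `Site.shift`/`Site.unshift` to `± unitVec`, the block map `blk`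
to `B5Blocks16.blockOf`, and the torus distance `T P 0` to `TorusG0Decay.ldist` (§1).  Under it Bałaban's matrix
`Marg_j = −Δ^{L^{−j}} + a_jQ_j^*Q_j` (`B4Ineq115Torus.Marg P a 0 j`; its inverse is `Grs`) is EXACTLY the
pv23-g3 operator `TorusG0Decay.torusOp n (Nv P j) a_j = −Δ^η + a_jQ^*Q`, `η = 1/(n+1) = L^{−j}`
(`Marg_mulVec_transport`, from `B1RG242Torus.hOp_mulVec`/`extMat_mulVec`/`avgMat_mulVec` against
`TorusG0Decay.torusOp_mulVec`), hence `G_j^{resc}(x,x′) = G0 (toTor x) (toTor x′)` (`Grs_eq_G0`,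
`Matrix.inv_submatrix_equiv`) and `(G_j^{resc}Q_j^*)(x,y) = (G0·1_{B(y)})(toTor x)` (`GrsQks_apply`) (§2).  The block
`B(y)` lies within `ldist ≤ L^j − 1` of its corner (`B5Ineq137Torus.T_blk_le`), so `edist(toTor x, B(y)) ≥
L^{−j}T(x, fine y) − 1` (`dist_sub_one_le_edist`), and `TransportLeg.block_legs` — the transported Combes–Thomas bound
`|(G0·1_{B(b)})(x)| ≤ K(2+a)/min{2,a}·e^{−δ_std(a)R}`, `|∇^η(G0·1_{B(b)})(x)| ≤ K(2+a)/min{2,a}·η·e^{−δ_std(a)R}` for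
`R ≤ edist(x, B(b))` — gives both legs at once; the gradient's factor `η = L^{−j}` cancels the `L^j` of
`∂^{L^{−j}}_μ = L^j(S_μ − 1)` exactly (§3–§4).

HONEST SCOPE.  (i) `m² = 0` only (the β road is massless; `TransportLeg` is typed for `H·G0 = 1` with
`H = −Δ^η + aQ^*Q`); (ii) `d ≥ 3` (hypothesis of `TransportLeg.block_legs`; the case of interest is `d = 4`);
(iii) nothing here touches the covariance family `CovDecay`/(2.37) or the `K2` clause; (iv) the constant `K(d)` of
`TransportLeg.block_legs` is existential there and is only NAMED here (`Kleg`, by choice) — no numerical value is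
claimed; (v) symmetry / right legs / the `LeafK123` clause plumbing are NOT redone (they are `Beta/LeafK123Clauses`).

Context (located, not used in proofs, not cited as facts).  [B4] p. 582, Lemma 2.4, (2.35): the value and
`∂^{L^{−j}}`-derivative block-leg bounds `≤ c₀e^{−δ₀|x−y|}`; [B5] p. 40 (1.136)–(1.137) applies them to the legs of the
one-loop kernels.  B4 = [cite: Balaban1983RegularityDecay]; B5 = [cite: Balaban1984PropagatorsI];
B1 = [cite: Balaban1982Higgs1] ((2.22) p. 610: the rescaled propagator `G_j`).
-/

namespace Literature.MathematicalPhysics.QuantumFieldTheory.Balaban1983to89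

open Matrix

noncomputable section

namespace Beta.LeafBlockLegs

open B1RG242Torus
open B5Prop11Plancherel (Tor fine unitVec)
open B5Display136Torus (Grs shift_unshift unshift_shift eq_shift_iff)
open B5Ineq137Torus (Nv T toT blk blk_val T_blk_le T_nonneg T_triangle pow_mul_sitesPerDir)
open B4Ineq115Torus (Marg Grs_eq)
open Beta.TorusG0Decay (torusOp torusOp_mulVec toSite ldist edist)
open Beta.TorusG0Kernel (G0)
open Beta.EffectiveKernel (deltaStd deltaStd_pos deltaStd_le_one)
open Beta.TransportLeg (block_legs)
open Beta.LeafK123Clauses (ValDecay GradDecay CovDecay BlockLegDecay)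

/-! ## §1. The dictionary `Site P 0 ≃ Tor (fine (n+1) (Nv P j))`, `n + 1 = L^j` -/

/-- The coarse torus `Site P j` read as `Tor (Nv P j)`: every period `N_j = 2L^{m+K−j}` is nonzero. [folklore] -/
instance instNeZeroNv (P : Params) (j : ℕ) (μ : Fin P.d) : NeZero (Nv P j μ) := ⟨P.sitesPerDir_ne_zero j⟩

variable {P : Params}

/-- `(n+1)·N_j = N_0` for `n + 1 = L^j`, `j ≤ m + K`: the fine torus over `T^{(j)}` with `n+1` points per block edge
has the periods of `T^{(0)}`. [folklore] -/
theorem fine_Nv_eq {n j : ℕ} (hn : n + 1 = P.L ^ j) (hj : j ≤ P.m + P.K) (μ : Fin P.d) :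
    fine (n + 1) (Nv P j) μ = P.sitesPerDir 0 := by
  show (n + 1) * P.sitesPerDir j = P.sitesPerDir 0
  rw [hn]
  exact pow_mul_sitesPerDir P hj

/-- The periods of `T^{(0)}` are `≥ 3` as soon as `1 ≤ j ≤ m + K` (`2L^{m+K} ≥ 2L ≥ 4`). [folklore] -/
theorem three_le_fine {n j : ℕ} (hn : n + 1 = P.L ^ j) (hj : j ≤ P.m + P.K) (hj1 : 1 ≤ j) (μ : Fin P.d) :
    3 ≤ fine (n + 1) (Nv P j) μ := by
  rw [fine_Nv_eq hn hj]
  show 3 ≤ 2 * P.L ^ (P.m + P.K - 0)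
  rw [Nat.sub_zero]
  have h2 : 2 ≤ P.L := P.hL.2
  have h3 : P.L ≤ P.L ^ (P.m + P.K) := Nat.le_self_pow (by omega) P.L
  omega

/-- Every level has a predecessor count: `L^j = n + 1`. [folklore] -/
theorem exists_pred_pow (P : Params) (j : ℕ) : ∃ n : ℕ, n + 1 = P.L ^ j :=
  ⟨P.L ^ j - 1, Nat.sub_add_cancel (Nat.one_le_pow _ _ P.L_pos)⟩

/-- `(n + 1 : ℝ) = L^j`. [folklore] -/
theorem cast_succ_eq {n j : ℕ} (hn : n + 1 = P.L ^ j) : ((n : ℝ) + 1) = (P.L : ℝ) ^ j := by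
  exact_mod_cast hn

/-- The dictionary map `T^{(0)} → Tor (fine (n+1) (Nv P j))`: the same coordinates `val`. [folklore] -/
def toTor (P : Params) (n j : ℕ) (x : Site P 0) : Tor (fine (n + 1) (Nv P j)) :=
  fun μ => (((x μ).val : ℕ) : ZMod (fine (n + 1) (Nv P j) μ))

/-- The inverse dictionary map: the same coordinates `val`. [folklore] -/
def ofTor (P : Params) (n j : ℕ) (t : Tor (fine (n + 1) (Nv P j))) : Site P 0 :=
  fun μ => (((t μ).val : ℕ) : ZMod (P.sitesPerDir 0))

/-- `toTor` preserves coordinates. [folklore] -/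
theorem val_toTor {n j : ℕ} (hn : n + 1 = P.L ^ j) (hj : j ≤ P.m + P.K) (x : Site P 0) (μ : Fin P.d) :
    (toTor P n j x μ).val = (x μ).val :=
  ZMod.val_cast_of_lt ((ZMod.val_lt (x μ)).trans_eq (fine_Nv_eq hn hj μ).symm)

/-- `ofTor` preserves coordinates. [folklore] -/
theorem val_ofTor {n j : ℕ} (hn : n + 1 = P.L ^ j) (hj : j ≤ P.m + P.K) (t : Tor (fine (n + 1) (Nv P j)))
    (μ : Fin P.d) : (ofTor P n j t μ).val = (t μ).val :=
  ZMod.val_cast_of_lt ((ZMod.val_lt (t μ)).trans_eq (fine_Nv_eq hn hj μ))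

/-- `ofTor ∘ toTor = id`. [folklore] -/
theorem ofTor_toTor {n j : ℕ} (hn : n + 1 = P.L ^ j) (hj : j ≤ P.m + P.K) (x : Site P 0) :
    ofTor P n j (toTor P n j x) = x :=
  funext fun μ => ZMod.val_injective _ (by rw [val_ofTor hn hj, val_toTor hn hj])

/-- `toTor ∘ ofTor = id`. [folklore] -/
theorem toTor_ofTor {n j : ℕ} (hn : n + 1 = P.L ^ j) (hj : j ≤ P.m + P.K) (t : Tor (fine (n + 1) (Nv P j))) :
    toTor P n j (ofTor P n j t) = t :=
  funext fun μ => ZMod.val_injective _ (by rw [val_toTor hn hj, val_ofTor hn hj])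

/-- The dictionary as an equivalence `T^{(0)} ≃ Tor (fine (n+1) (Nv P j))`. [folklore] -/
def torEquiv {n j : ℕ} (hn : n + 1 = P.L ^ j) (hj : j ≤ P.m + P.K) : Site P 0 ≃ Tor (fine (n + 1) (Nv P j)) where
  toFun := toTor P n j
  invFun := ofTor P n j
  left_inv := ofTor_toTor hn hj
  right_inv := toTor_ofTor hn hj

/-- `torEquiv` is `toTor`. [folklore] -/
@[simp] theorem torEquiv_apply {n j : ℕ} (hn : n + 1 = P.L ^ j) (hj : j ≤ P.m + P.K) (z : Site P 0) :
    torEquiv hn hj z = toTor P n j z := rfl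

/-- Casting a residue class through its `val` along equal (hence dividing) moduli is the ring map `castHom`.
[folklore] -/
theorem natCast_val_eq_castHom {N N₀ : ℕ} [NeZero N₀] (h : N ∣ N₀) (z : ZMod N₀) :
    (((z.val : ℕ)) : ZMod N) = ZMod.castHom h (ZMod N) z := by
  rw [ZMod.castHom_apply, ZMod.cast_eq_val]

/-- The dictionary carries `x + e_μ` (`Site.shift`) to `+ unitVec μ`. [folklore] -/
theorem toTor_shift {n j : ℕ} (hn : n + 1 = P.L ^ j) (hj : j ≤ P.m + P.K) (x : Site P 0) (μ : Fin P.d) :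
    toTor P n j (Site.shift x μ) = toTor P n j x + unitVec (fine (n + 1) (Nv P j)) μ := by
  funext ν
  have hdv : fine (n + 1) (Nv P j) ν ∣ P.sitesPerDir 0 := dvd_of_eq (fine_Nv_eq hn hj ν)
  show (((Site.shift x μ ν).val : ℕ) : ZMod (fine (n + 1) (Nv P j) ν))
      = (((x ν).val : ℕ) : ZMod (fine (n + 1) (Nv P j) ν)) + unitVec (fine (n + 1) (Nv P j)) μ ν
  rw [natCast_val_eq_castHom hdv, natCast_val_eq_castHom hdv]
  unfold Site.shift unitVec
  by_cases h : ν = μ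
  · subst h
    rw [Function.update_self, Pi.single_eq_same, map_add, map_one]
  · rw [Function.update_of_ne h, Pi.single_eq_of_ne h, add_zero]

/-- The dictionary carries `x − e_μ` (`Site.unshift`) to `− unitVec μ`. [folklore] -/
theorem toTor_unshift {n j : ℕ} (hn : n + 1 = P.L ^ j) (hj : j ≤ P.m + P.K) (x : Site P 0) (μ : Fin P.d) :
    toTor P n j (Site.unshift x μ) = toTor P n j x - unitVec (fine (n + 1) (Nv P j)) μ := by
  funext ν
  have hdv : fine (n + 1) (Nv P j) ν ∣ P.sitesPerDir 0 := dvd_of_eq (fine_Nv_eq hn hj ν)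
  show (((Site.unshift x μ ν).val : ℕ) : ZMod (fine (n + 1) (Nv P j) ν))
      = (((x ν).val : ℕ) : ZMod (fine (n + 1) (Nv P j) ν)) - unitVec (fine (n + 1) (Nv P j)) μ ν
  rw [natCast_val_eq_castHom hdv, natCast_val_eq_castHom hdv]
  unfold Site.unshift unitVec
  by_cases h : ν = μ
  · subst h
    rw [Function.update_self, Pi.single_eq_same, map_sub, map_one]
  · rw [Function.update_of_ne h, Pi.single_eq_of_ne h, sub_zero]

/-- Coordinates of the block of a fine site: `⌊v(t_ν)/n'⌋` (`B5Blocks16.bpt_val`). [folklore] -/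
theorem val_blockOf {d : ℕ} (n' : ℕ) [NeZero n'] (M : Fin d → ℕ) [∀ μ, NeZero (M μ)] (t : Tor (fine n' M))
    (ν : Fin d) : (B5Blocks16.blockOf n' M t ν).val = (t ν).val / n' := by
  obtain ⟨⟨y, c⟩, h⟩ := (B5Blocks16.bpt_bijective n' M).2 t
  simp only at h
  subst h
  rw [B5Blocks16.blockOf_bpt, B5Blocks16.bpt_val, Nat.mul_add_div (Nat.pos_of_ne_zero (NeZero.ne n')),
    Nat.div_eq_of_lt (c ν).is_lt, add_zero]

/-- The dictionary carries Bałaban's block map `blk` (division of coordinates by `L^j`) to `B5Blocks16.blockOf`.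
[folklore] -/
theorem blockOf_toTor {n j : ℕ} (hn : n + 1 = P.L ^ j) (hj : j ≤ P.m + P.K) (x : Site P 0) :
    B5Blocks16.blockOf (n + 1) (Nv P j) (toTor P n j x) = blk P j x := by
  funext ν
  refine ZMod.val_injective _ ?_
  show (B5Blocks16.blockOf (n + 1) (Nv P j) (toTor P n j x) ν).val = (blk P j x ν).val
  rw [val_blockOf, val_toTor hn hj, blk_val P hj, hn]

/-- The sup torus distance only sees the coordinates `val` and the periods. [folklore] -/
theorem tdist_congr_val {d : ℕ} {N N' : Fin d → ℕ} (h : N = N') (x y : B4Sect5Torus.TSite d N)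
    (x' y' : B4Sect5Torus.TSite d N') (hx : ∀ i, (x i).val = (x' i).val) (hy : ∀ i, (y i).val = (y' i).val) :
    B4Sect5Torus.tdist N x y = B4Sect5Torus.tdist N' x' y' := by
  subst h
  obtain rfl : x = x' := funext fun i => Fin.ext (hx i)
  obtain rfl : y = y' := funext fun i => Fin.ext (hy i)
  rfl

/-- The dictionary carries the torus distance `T` of `T^{(0)}` to `TorusG0Decay.ldist`. [folklore] -/
theorem ldist_toTor {n j : ℕ} (hn : n + 1 = P.L ^ j) (hj : j ≤ P.m + P.K) (x x' : Site P 0) :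
    ldist (fine (n + 1) (Nv P j)) (toTor P n j x) (toTor P n j x') = T P 0 x x' := by
  have hN : fine (n + 1) (Nv P j) = Nv P 0 := funext fun μ => fine_Nv_eq hn hj μ
  unfold TorusG0Decay.ldist B5Ineq137Torus.T
  exact tdist_congr_val hN _ _ _ _ (fun i => val_toTor hn hj x i) (fun i => val_toTor hn hj x' i)

/-! ## §2. `Marg_j = −Δ^{L^{−j}} + a_jQ_j^*Q_j` on `T^{(0)}` IS `torusOp n (Nv P j) a_j`; hence `Grs = G0` -/

section Lattice

variable {i : ℕ}

/-- `(S_μ M)(x,y) = M(x+e_μ, y)`. [folklore] -/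
theorem shiftMat_mul_apply {ι : Type*} (μ : Fin P.d) (M : Matrix (Site P i) ι ℝ) (x : Site P i) (y : ι) :
    (shiftMat P i μ * M) x y = M (Site.shift x μ) y := by
  simp only [Matrix.mul_apply, shiftMat, ite_mul, one_mul, zero_mul]
  rw [Finset.sum_ite_eq', if_pos (Finset.mem_univ _)]

/-- `(∂^s_μ M)(x,y) = s^{−1}(M(x+e_μ,y) − M(x,y))` (B1 (1.4) on the first variable of a kernel). [folklore] -/
theorem deriv_mul_apply {ι : Type*} (s : ℝ) (μ : Fin P.d) (M : Matrix (Site P i) ι ℝ) (x : Site P i) (y : ι) :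
    (B1RG242Torus.deriv P i s μ * M) x y = s⁻¹ * (M (Site.shift x μ) y - M x y) := by
  rw [B1RG242Torus.deriv, Matrix.smul_mul, Matrix.sub_mul, Matrix.one_mul, Matrix.smul_apply, Matrix.sub_apply,
    shiftMat_mul_apply, smul_eq_mul]

/-- `(S_μᵀ h)(x) = h(x − e_μ)`. [folklore] -/
theorem shiftMat_transpose_mulVec (μ : Fin P.d) (h : Site P i → ℝ) (x : Site P i) :
    ((shiftMat P i μ)ᵀ *ᵥ h) x = h (Site.unshift x μ) := by
  simp only [Matrix.mulVec, dotProduct, Matrix.transpose_apply, shiftMat, ite_mul, one_mul, zero_mul]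
  simp_rw [eq_shift_iff x _ μ]
  rw [Finset.sum_ite_eq', if_pos (Finset.mem_univ _)]

/-- `(∂^{sᵀ}_μ h)(x) = s^{−1}(h(x − e_μ) − h(x))`. [folklore] -/
theorem deriv_transpose_mulVec (s : ℝ) (μ : Fin P.d) (h : Site P i → ℝ) (x : Site P i) :
    ((B1RG242Torus.deriv P i s μ)ᵀ *ᵥ h) x = s⁻¹ * (h (Site.unshift x μ) - h x) := by
  rw [B1RG242Torus.deriv, Matrix.transpose_smul, Matrix.transpose_sub, Matrix.transpose_one, Matrix.smul_mulVec,
    Matrix.sub_mulVec, Matrix.one_mulVec, Pi.smul_apply, Pi.sub_apply, shiftMat_transpose_mulVec, smul_eq_mul]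

end Lattice

/-- The rescaled spacing: `ε/(L^jε) = L^{−j}`. [folklore] -/
theorem eps_div_spacing (P : Params) (j : ℕ) : P.eps / P.spacing j = ((P.L : ℝ) ^ j)⁻¹ := by
  rw [Params.spacing, mul_comm, ← div_div, div_self P.eps_pos.ne', one_div]

/-- THE OPERATOR IDENTITY.  For `n + 1 = L^j`, `1 ≤ j ≤ m + K`, Bałaban's `Marg_j = −Δ^{L^{−j}} + a_jQ_j^*Q_j` acting on
`g : T^{(0)} → ℝ` is `torusOp n (Nv P j) a_j` acting on `g ∘ ofTor`, read back along `toTor`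
(`B1RG242Torus.hOp_mulVec`/`extMat_mulVec`/`avgMat_mulVec` versus `TorusG0Decay.torusOp_mulVec`). [folklore] -/
theorem Marg_mulVec_transport {a : ℝ} {n j : ℕ} (hn : n + 1 = P.L ^ j) (hj : j ≤ P.m + P.K) (hj1 : 1 ≤ j)
    (g : Site P 0 → ℝ) (x : Site P 0) :
    (Marg P a 0 j *ᵥ g) x
      = (torusOp n (Nv P j) (B1.aSeq a P.L j) *ᵥ fun t => g (ofTor P n j t)) (toTor P n j x) := by
  have e0 : g (ofTor P n j (toTor P n j x)) = g x := by rw [ofTor_toTor hn hj]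
  have e1 : ∀ μ, g (ofTor P n j (toTor P n j x + unitVec (fine (n + 1) (Nv P j)) μ)) = g (Site.shift x μ) :=
    fun μ => by rw [← toTor_shift hn hj, ofTor_toTor hn hj]
  have e2 : ∀ μ, g (ofTor P n j (toTor P n j x - unitVec (fine (n + 1) (Nv P j)) μ)) = g (Site.unshift x μ) :=
    fun μ => by rw [← toTor_unshift hn hj, ofTor_toTor hn hj]
  have hw : (((P.L : ℝ) ^ P.d)⁻¹) ^ j = (((n : ℝ) + 1) ^ P.d)⁻¹ := by
    rw [cast_succ_eq hn, inv_pow, ← pow_mul, ← pow_mul, mul_comm]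
  rw [B4Ineq115Torus.Marg, Matrix.add_mulVec, Pi.add_apply, torusOp_mulVec n (Nv P j) (three_le_fine hn hj hj1)]
  congr 1
  · rw [hOp_mulVec, Pi.add_apply, Pi.smul_apply, smul_eq_mul, mul_zero, zero_mul, zero_add, Finset.sum_apply,
      eps_div_spacing, cast_succ_eq hn, Finset.mul_sum]
    refine Finset.sum_congr rfl fun μ _ => ?_
    simp only [deriv_transpose_mulVec, deriv_mulVec, shift_unshift, inv_inv, e0, e1, e2]
    ring
  · rw [Matrix.smul_mulVec, Pi.smul_apply, smul_eq_mul, ← Matrix.mulVec_mulVec, B1RG242Torus.Qks, extMat_mulVec,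
      B1RG242Torus.Qk, avgMat_mulVec, lvl_of_le P hj, Finset.sum_filter, div_eq_mul_inv, mul_assoc]
    congr 1
    rw [Finset.mul_sum]
    refine Fintype.sum_equiv (torEquiv hn hj) _ _ fun z => ?_
    rw [torEquiv_apply, ofTor_toTor hn hj, blockOf_toTor hn hj, blockOf_toTor hn hj]
    split_ifs with h₁ h₂ h₃ <;>
      first
        | exact absurd h₁ h₂
        | exact absurd h₂ h₁
        | exact absurd h₁ h₃
        | exact absurd h₃ h₁
        | (rw [hw])
        | (rw [mul_zero])

/-- A point mass on `T^{(0)}` pulled back along `ofTor` is the point mass at the image site. [folklore] -/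
theorem single_ofTor {n j : ℕ} (hn : n + 1 = P.L ^ j) (hj : j ≤ P.m + P.K) (x' : Site P 0) :
    (fun t => (Pi.single x' (1 : ℝ) : Site P 0 → ℝ) (ofTor P n j t)) = Pi.single (toTor P n j x') 1 := by
  funext t
  by_cases h : t = toTor P n j x'
  · rw [h, ofTor_toTor hn hj, Pi.single_eq_same, Pi.single_eq_same]
  · have h' : ofTor P n j t ≠ x' := fun h' => h (by rw [← h', toTor_ofTor hn hj])
    rw [Pi.single_eq_of_ne h', Pi.single_eq_of_ne h]

/-- `Marg_j` is the pull-back of `torusOp n (Nv P j) a_j` along the dictionary (entrywise form of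
`Marg_mulVec_transport`). [folklore] -/
theorem Marg_eq_submatrix {a : ℝ} {n j : ℕ} (hn : n + 1 = P.L ^ j) (hj : j ≤ P.m + P.K) (hj1 : 1 ≤ j) :
    Marg P a 0 j = (torusOp n (Nv P j) (B1.aSeq a P.L j)).submatrix (torEquiv hn hj) (torEquiv hn hj) := by
  ext x x'
  have h1 : Marg P a 0 j x x' = (Marg P a 0 j *ᵥ Pi.single x' 1) x := by
    rw [Matrix.mulVec_single_one, Matrix.col_apply]
  have h2 : torusOp n (Nv P j) (B1.aSeq a P.L j) (toTor P n j x) (toTor P n j x')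
      = (torusOp n (Nv P j) (B1.aSeq a P.L j) *ᵥ Pi.single (toTor P n j x') 1) (toTor P n j x) := by
    rw [Matrix.mulVec_single_one, Matrix.col_apply]
  rw [Matrix.submatrix_apply, torEquiv_apply, torEquiv_apply, h1, h2, Marg_mulVec_transport hn hj hj1,
    single_ofTor hn hj]

/-- THE KERNEL IDENTITY: `G_j^{resc}(x,x′) = G0 (toTor x) (toTor x′)` — Bałaban's rescaled propagator of the massless
scalar tower is the pv23-g3 kernel `TorusG0Kernel.G0 n (Nv P j) a_j` (`Matrix.inv_submatrix_equiv`). [folklore] -/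
theorem Grs_eq_G0 {a : ℝ} {n j : ℕ} (hn : n + 1 = P.L ^ j) (hj : j ≤ P.m + P.K) (hj1 : 1 ≤ j) (x x' : Site P 0) :
    Grs P a 0 j x x' = G0 n (Nv P j) (B1.aSeq a P.L j) (toTor P n j x) (toTor P n j x') := by
  rw [B4Ineq115Torus.Grs_eq, Marg_eq_submatrix hn hj hj1, Matrix.inv_submatrix_equiv, Matrix.submatrix_apply,
    torEquiv_apply, torEquiv_apply]
  rfl

/-- THE BLOCK-LEG IDENTITY: `(G_j^{resc}Q_j^*)(x,y) = (G0·1_{B(y)})(toTor x)` — the value leg is the potential of the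
block indicator of `B(y)` under `G0`. [folklore] -/
theorem GrsQks_apply {a : ℝ} {n j : ℕ} (hn : n + 1 = P.L ^ j) (hj : j ≤ P.m + P.K) (hj1 : 1 ≤ j) (x : Site P 0)
    (y : Site P j) :
    (Grs P a 0 j * Qks P j) x y
      = (G0 n (Nv P j) (B1.aSeq a P.L j)).mulVec
          (fun k => if B5Blocks16.blockOf (n + 1) (Nv P j) k = y then (1 : ℝ) else 0) (toTor P n j x) := by
  rw [Matrix.mul_apply]
  simp only [Matrix.mulVec, dotProduct]
  refine Fintype.sum_equiv (torEquiv hn hj) _ _ fun w => ?_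
  rw [torEquiv_apply, Grs_eq_G0 hn hj hj1 x w, blockOf_toTor hn hj]
  congr 1
  show (if Site.proj j (lvl P j) w = y then (1 : ℝ) else 0) = _
  rw [lvl_of_le P hj]
  split_ifs with h₁ h₂ h₃ <;>
    first
      | rfl
      | exact absurd h₁ h₂
      | exact absurd h₂ h₁
      | exact absurd h₁ h₃
      | exact absurd h₃ h₁

/-! ## §3. Constants free of `j, L, m, K`; the one weakening step; the block-to-corner distance -/

/-- `K(d)`: the constant of `TransportLeg.block_legs` (existential there; named here by choice, `0` below `d = 3`).
[folklore] -/
def Kleg (d : ℕ) : ℝ := if hd : 3 ≤ d then Classical.choose (block_legs (d := d) hd) else 0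

/-- The leg decay rate `δ_leg(d,a) = min{2, a/2}/(4(d+a+1))` (`= δ_std(a/2)` with `a/2 ↦ a` in the denominator):
a lower bound of `δ_std(a′)` over `a′ ∈ [a/2, a]`. [folklore] -/
def dLeg (d : ℕ) (a : ℝ) : ℝ := min 2 (a / 2) / (4 * ((d : ℝ) + a + 1))

/-- The leg constant `c_leg(d,a) = K(d)·(2+a)/min{2,a/2}·e`. [folklore] -/
def cLeg (d : ℕ) (a : ℝ) : ℝ := Kleg d * ((2 + a) / min 2 (a / 2)) * Real.exp 1

/-- `0 ≤ K(d)`. [folklore] -/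
theorem Kleg_nonneg (d : ℕ) : 0 ≤ Kleg d := by
  unfold Kleg
  split_ifs with hd
  · exact (Classical.choose_spec (block_legs hd)).1
  · exact le_rfl

/-- `TransportLeg.block_legs` with its constant named `Kleg d`. [folklore] -/
theorem Kleg_spec {d : ℕ} (hd : 3 ≤ d) :
    ∀ (n : ℕ) (M : Fin d → ℕ) [∀ μ, NeZero (M μ)], (∀ μ, 3 ≤ fine (n + 1) M μ) →
    ∀ (a : ℝ), 0 < a → ∀ (b : Tor M) (x : Tor (fine (n + 1) M)) (R : ℝ),
      (∀ t, B5Blocks16.blockOf (n + 1) M t = b → R ≤ edist n M x t) →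
      |(G0 n M a).mulVec (fun k => if B5Blocks16.blockOf (n + 1) M k = b then (1 : ℝ) else 0) x|
          ≤ Kleg d * ((2 + a) / min 2 a) * Real.exp (-(deltaStd d a * R)) ∧
      ∀ μ : Fin d,
        |(G0 n M a).mulVec (fun k => if B5Blocks16.blockOf (n + 1) M k = b then (1 : ℝ) else 0)
              (x + unitVec (fine (n + 1) M) μ) -
            (G0 n M a).mulVec (fun k => if B5Blocks16.blockOf (n + 1) M k = b then (1 : ℝ) else 0) x|
          ≤ Kleg d * ((2 + a) / min 2 a) / ((n : ℝ) + 1) * Real.exp (-(deltaStd d a * R)) := by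
  have hK : Kleg d = Classical.choose (block_legs hd) := by
    unfold Kleg
    rw [dif_pos hd]
  rw [hK]
  exact (Classical.choose_spec (block_legs hd)).2

/-- `0 < δ_leg`. [folklore] -/
theorem dLeg_pos {d : ℕ} {a : ℝ} (ha : 0 < a) : 0 < dLeg d a := by
  unfold dLeg
  have : 0 < min 2 (a / 2) := lt_min two_pos (half_pos ha)
  positivity

/-- `0 ≤ c_leg`. [folklore] -/
theorem cLeg_nonneg {d : ℕ} {a : ℝ} (ha : 0 < a) : 0 ≤ cLeg d a := by
  unfold cLeg
  have : 0 < min 2 (a / 2) := lt_min two_pos (half_pos ha)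
  exact mul_nonneg (mul_nonneg (Kleg_nonneg d) (div_nonneg (by linarith) this.le)) (Real.exp_pos 1).le

/-- Bałaban's `a_j` stays in `[a/2, a]`: `a(1 − L^{−2}) < a_j ≤ a` (`B1.ainf_lt_aSeq`, `B1.aSeq_le`) and `L ≥ 2`.
[folklore] -/
theorem aSeq_range (P : Params) {a : ℝ} (ha : 0 < a) {j : ℕ} (hj1 : 1 ≤ j) :
    a / 2 ≤ B1.aSeq a P.L j ∧ B1.aSeq a P.L j ≤ a := by
  have hL := one_lt_cast_L P
  refine ⟨?_, B1.aSeq_le ha hL j hj1⟩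
  have h := B1.ainf_lt_aSeq ha hL j hj1
  have h2n : 2 ≤ P.L := P.hL.2
  have h2 : (2 : ℝ) ≤ P.L := by exact_mod_cast h2n
  have h4 : (4 : ℝ) ≤ (P.L : ℝ) ^ 2 := by nlinarith
  have hinv : ((P.L : ℝ) ^ 2)⁻¹ ≤ 4⁻¹ := inv_anti₀ (by norm_num) h4
  nlinarith [mul_le_mul_of_nonneg_left hinv ha.le]

/-- THE WEAKENING STEP: a `block_legs`-shaped bound at parameter `a′ ∈ [a/2, a]` and distance `D − 1` is a bound with
the `j`-free constants `(c_leg, δ_leg)` at distance `D ≥ 0` (`δ_leg(a) ≤ δ_std(a′) ≤ 1`,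
`(2+a′)/min{2,a′} ≤ (2+a)/min{2,a/2}`, `e^{−δ(D−1)} ≤ e·e^{−δ_leg D}`). [folklore] -/
theorem weaken {d : ℕ} {a a' D v : ℝ} (ha : 0 < a) (h1 : a / 2 ≤ a') (h2 : a' ≤ a) (hD : 0 ≤ D)
    (hv : v ≤ Kleg d * ((2 + a') / min 2 a') * Real.exp (-(deltaStd d a' * (D - 1)))) :
    v ≤ cLeg d a * Real.exp (-(dLeg d a * D)) := by
  have ha' : 0 < a' := by linarith
  have hm : 0 < min 2 (a / 2) := lt_min two_pos (by linarith)
  have hm' : 0 < min 2 a' := lt_min two_pos ha'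
  have hr : (2 + a') / min 2 a' ≤ (2 + a) / min 2 (a / 2) :=
    div_le_div₀ (by linarith) (by linarith) hm (min_le_min le_rfl h1)
  have hδ : dLeg d a ≤ deltaStd d a' := by
    unfold dLeg deltaStd
    exact div_le_div₀ hm'.le (min_le_min le_rfl h1) (by positivity) (by linarith)
  have hδ1 : deltaStd d a' ≤ 1 := deltaStd_le_one ha'
  have hexp : Real.exp (-(deltaStd d a' * (D - 1))) ≤ Real.exp 1 * Real.exp (-(dLeg d a * D)) := by
    rw [← Real.exp_add]
    apply Real.exp_le_exp.mpr
    have := mul_le_mul_of_nonneg_right hδ hD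
    linarith
  calc v ≤ _ := hv
    _ ≤ Kleg d * ((2 + a) / min 2 (a / 2)) * (Real.exp 1 * Real.exp (-(dLeg d a * D))) :=
        mul_le_mul (mul_le_mul_of_nonneg_left hr (Kleg_nonneg d)) hexp (Real.exp_pos _).le
          (mul_nonneg (Kleg_nonneg d) (div_nonneg (by linarith) hm.le))
    _ = cLeg d a * Real.exp (-(dLeg d a * D)) := by unfold cLeg; ring

/-- THE BLOCK-TO-CORNER DISTANCE: every point `t` of the block `B(y)` of the fine torus satisfies
`edist(toTor x, t) ≥ L^{−j}T(x, fine y) − 1` (`B5Ineq137Torus.T_blk_le`: a fine site is within `L^j − 1` of the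
corner of its block; triangle inequality; `edist = L^{−j}·ldist = L^{−j}·T`). [folklore] -/
theorem dist_sub_one_le_edist {n j : ℕ} (hn : n + 1 = P.L ^ j) (hj : j ≤ P.m + P.K) (x : Site P 0) (y : Site P j)
    (t : Tor (fine (n + 1) (Nv P j))) (ht : B5Blocks16.blockOf (n + 1) (Nv P j) t = y) :
    ((P.L : ℝ) ^ j)⁻¹ * T P 0 x (B5Ineq137Torus.fine P j y) - 1 ≤ edist n (Nv P j) (toTor P n j x) t := by
  obtain ⟨p, rfl⟩ : ∃ p, t = toTor P n j p := ⟨ofTor P n j t, (toTor_ofTor hn hj t).symm⟩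
  rw [blockOf_toTor hn hj] at ht
  have hblk : blk P j p = y := ht
  have hL : (0 : ℝ) < (P.L : ℝ) ^ j := pow_pos P.cast_L_pos _
  have hi : (0 : ℝ) ≤ ((P.L : ℝ) ^ j)⁻¹ := inv_nonneg.mpr hL.le
  have hed : edist n (Nv P j) (toTor P n j x) (toTor P n j p) = ((P.L : ℝ) ^ j)⁻¹ * T P 0 x p := by
    unfold TorusG0Decay.edist
    rw [ldist_toTor hn hj, cast_succ_eq hn, one_div]
  have h2 : T P 0 p (B5Ineq137Torus.fine P j y) ≤ (P.L : ℝ) ^ j - 1 := by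
    have h := T_blk_le P hj p
    rwa [hblk] at h
  have h3 : T P 0 x (B5Ineq137Torus.fine P j y) ≤ T P 0 x p + ((P.L : ℝ) ^ j - 1) :=
    (T_triangle P 0 x p _).trans (add_le_add le_rfl h2)
  have h4 := mul_le_mul_of_nonneg_left h3 hi
  have h1 : ((P.L : ℝ) ^ j)⁻¹ * ((P.L : ℝ) ^ j - 1) = 1 - ((P.L : ℝ) ^ j)⁻¹ := by
    rw [mul_sub, inv_mul_cancel₀ hL.ne', mul_one]
  rw [hed]
  linarith [h4, h1, hi]

/-- THE VALUE LEG at one level: `|(G_j^{resc}Q_j^*)(x,y)| ≤ c_leg·e^{−δ_leg·L^{−j}T(x, fine y)}` (`GrsQks_apply` +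
`TransportLeg.block_legs` at `a_j` + `weaken`). [folklore] -/
theorem value_leg (hd : 3 ≤ P.d) {a : ℝ} (ha : 0 < a) {n j : ℕ} (hn : n + 1 = P.L ^ j) (hj : j ≤ P.m + P.K)
    (hj1 : 1 ≤ j) (x : Site P 0) (y : Site P j) :
    |(Grs P a 0 j * Qks P j) x y|
      ≤ cLeg P.d a * Real.exp (-(dLeg P.d a * (((P.L : ℝ) ^ j)⁻¹ * T P 0 x (B5Ineq137Torus.fine P j y)))) := by
  obtain ⟨h1, h2⟩ := aSeq_range P ha hj1
  have ha' : 0 < B1.aSeq a P.L j := by linarith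
  have hD : (0 : ℝ) ≤ ((P.L : ℝ) ^ j)⁻¹ * T P 0 x (B5Ineq137Torus.fine P j y) :=
    mul_nonneg (inv_nonneg.mpr (pow_pos P.cast_L_pos _).le) (T_nonneg P 0 _ _)
  have hK := (Kleg_spec hd n (Nv P j) (three_le_fine hn hj hj1) (B1.aSeq a P.L j) ha' y (toTor P n j x) _
    (fun t ht => dist_sub_one_le_edist hn hj x y t ht)).1
  rw [GrsQks_apply hn hj hj1]
  exact weaken ha h1 h2 hD hK

/-- THE GRADIENT LEG at one level: `|(∂^{L^{−j}}_μ G_j^{resc}Q_j^*)(x,y)| ≤ c_leg·e^{−δ_leg·L^{−j}T(x, fine y)}` — the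
factor `η = 1/(n+1) = L^{−j}` of the `block_legs` gradient bound cancels the `L^j` of `∂^{L^{−j}}_μ = L^j(S_μ − 1)`.
[folklore] -/
theorem grad_leg (hd : 3 ≤ P.d) {a : ℝ} (ha : 0 < a) {n j : ℕ} (hn : n + 1 = P.L ^ j) (hj : j ≤ P.m + P.K)
    (hj1 : 1 ≤ j) (μ : Fin P.d) (x : Site P 0) (y : Site P j) :
    |(deriv P 0 (P.eps / P.spacing j) μ * Grs P a 0 j * Qks P j) x y|
      ≤ cLeg P.d a * Real.exp (-(dLeg P.d a * (((P.L : ℝ) ^ j)⁻¹ * T P 0 x (B5Ineq137Torus.fine P j y)))) := by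
  obtain ⟨h1, h2⟩ := aSeq_range P ha hj1
  have ha' : 0 < B1.aSeq a P.L j := by linarith
  have hLj : (0 : ℝ) < (P.L : ℝ) ^ j := pow_pos P.cast_L_pos _
  have hD : (0 : ℝ) ≤ ((P.L : ℝ) ^ j)⁻¹ * T P 0 x (B5Ineq137Torus.fine P j y) :=
    mul_nonneg (inv_nonneg.mpr hLj.le) (T_nonneg P 0 _ _)
  have hK := (Kleg_spec hd n (Nv P j) (three_le_fine hn hj hj1) (B1.aSeq a P.L j) ha' y (toTor P n j x) _
    (fun t ht => dist_sub_one_le_edist hn hj x y t ht)).2 μ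
  rw [cast_succ_eq hn, ← toTor_shift hn hj, ← GrsQks_apply hn hj hj1, ← GrsQks_apply hn hj hj1] at hK
  have h := mul_le_mul_of_nonneg_left hK hLj.le
  rw [← mul_assoc, mul_div_assoc', mul_div_cancel_left₀ _ hLj.ne'] at h
  rw [Matrix.mul_assoc, deriv_mul_apply, eps_div_spacing, inv_inv, abs_mul, abs_of_pos hLj]
  exact weaken ha h1 h2 hD h

/-! ## §4. The two hypothesis fields of `LeafK123Clauses.BlockLegDecay` for the massless scalar tower -/

/-- **THE VALUE BLOCK LEGS** of the massless scalar torus tower (the value member of (2.35) for OUR concrete tower,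
kernel-checked, all levels `1 ≤ j ≤ m + K`, constants `c_leg(d,a)`, `δ_leg(d,a)` free of `j, L, m, K`):
`ValDecay P a 0 (cLeg P.d a) (dLeg P.d a)`. [folklore] -/
theorem valDecay (hd : 3 ≤ P.d) {a : ℝ} (ha : 0 < a) : ValDecay P a 0 (cLeg P.d a) (dLeg P.d a) := by
  intro j hj1 hj x y
  obtain ⟨n, hn⟩ := exists_pred_pow P j
  exact value_leg hd ha hn hj hj1 x y

/-- **THE GRADIENT BLOCK LEGS** of the massless scalar torus tower (the `∂^{L^{−j}}`-member of (2.35) for OUR concrete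
tower, kernel-checked): `GradDecay P a 0 (cLeg P.d a) (dLeg P.d a)`. [folklore] -/
theorem gradDecay (hd : 3 ≤ P.d) {a : ℝ} (ha : 0 < a) : GradDecay P a 0 (cLeg P.d a) (dLeg P.d a) := by
  intro j hj1 hj μ x y
  obtain ⟨n, hn⟩ := exists_pred_pow P j
  exact grad_leg hd ha hn hj hj1 μ x y

/-- **THE SUPPLIER PACKAGE MODULO THE COVARIANCE FAMILY**: for the massless scalar torus tower in `d ≥ 3`, any
covariance decay `CovDecay P a 0 c₃ δ₃` (the (2.37) family, not treated here) completes `BlockLegDecay`, whence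
`LeafK123Clauses.leafK123_data{M,V,G}` and the three `(W3a)₀` tails `{mixed,value,grad}Leg_tail_of_blockLegDecay`.
[folklore] -/
theorem blockLegDecay_of_covDecay (hd : 3 ≤ P.d) {a c₃ δ₃ : ℝ} (ha : 0 < a) (h₃ : 0 ≤ c₃)
    (hcov : CovDecay P a 0 c₃ δ₃) : BlockLegDecay P a 0 (max (cLeg P.d a) c₃) (min (dLeg P.d a) δ₃) :=
  ⟨(valDecay hd ha).mono (cLeg_nonneg ha) (le_max_left _ _) (min_le_left _ _),
   (gradDecay hd ha).mono (cLeg_nonneg ha) (le_max_left _ _) (min_le_left _ _),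
   hcov.mono h₃ (le_max_right _ _) (min_le_right _ _)⟩

/-- Sanity: the leg constants are honest numbers (`0 < δ_leg`, `0 ≤ c_leg`) at `d = 4`, `a = 1`. [folklore] -/
example : 0 < dLeg 4 1 ∧ 0 ≤ cLeg 4 1 := ⟨dLeg_pos one_pos, cLeg_nonneg one_pos⟩

end Beta.LeafBlockLegs

end

end Literature.MathematicalPhysics.QuantumFieldTheory.Balaban1983to89
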